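import Literature.NumberTheory.GelbartRogawski1991.LocalScaleModelTransport
import Literature.NumberTheory.GelbartRogawski1991.LocalKudlaSplittingRigidity
import Literature.NumberTheory.GelbartRogawski1991.LocalUnitaryUndoubling
import HarnessLib

-- buildfix G11b-3 recipe (LEDGER B13-1/B13-3), as in the GelbartRogawski1991 siblings: elaborate sequentially so the
-- trailing `attribute [implicit_reducible]` block is in force at `.olean` export (inert for the kernel).
set_option Elab.async false

/-!
# The scale-model transport commutes with undoubling and carries the parabolic normalisation

Topic `NumberTheory/GelbartRogawski1991`; namespace `Literature.NumberTheory.GelbartRogawski1991.UnitaryDualPair.LocalSplitting`.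
KERNEL mathematics only: theorems; no definition, no named fact, no `sorry`.  Cell hodgecm-mathlib, line a4-liuD3
(`stub_iso_of_params`, step S6a), sequel of `LocalScaleModelTransport` (the transport `(a•T, δ) ≅ (T, δ/a)` of sections
into MVW's `S̃p_ψ`, for a Gram matrix and its multiple) and of `LocalKudlaSplittingRigidity` (rigidity of `P_Δ`-normalised
sections of the DOUBLED group `H = U(J ⊕ −J)`), for the doubled Gram matrices `gramD n (a•T₀) = a • gramD n T₀`:

* §1 (generic `S̃p_ψ`) an element is determined by its projection and its Weil operator (`MpPsi.ext_of_proj_of_toRep`);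
  every element of the `T`-model is the transport of an element of the `T′`-model (`exists_scaleTransportElt_eq`, same operator,
  projection `e′_a⁻¹ π(m) e′_a`).
* §2 `e′_a = lineScale` preserves Kudla's Lagrangian `ℓ_Δ` and the Lagrangian `ℓ_Y` of the doubled space
  (`map_lineScale_deltaLagrangian`, `map_lineScale_symm_lagrangianY`); the Siegel parabolic, `det_Δ` and `χ_v ∘ det_Δ` do
  not see the retyping `scaleInl` (`isSiegelDelta_scaleInl_iff`, `detDelta_scaleInl`, `chiDet_scaleInl`); `g ⊕ 1` commutes
  with the retyping (`inlLoc_scaleInl`).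
* §3 **`scaleTransportSection_undoubleLoc`** — UNDOUBLING COMMUTES WITH THE SCALE TRANSPORT: for a section `s^𝔻` of
  `H′ = U(a•(J ⊕ −J))` over `ι^{𝔻}_δ`, transporting the undoubled section `undoubleLoc s^𝔻 : U(a•J) →* S̃p(β_{a•T₀})` to the
  `(T₀, δ/a)`-model equals undoubling the transported doubled section (same projections `ι^{T₀}_{δ/a}`, same operators:
  `ω(s^𝔻(g ⊕ 1))(f₁ ⊠ f₂) = ω(undoubleLoc s^𝔻 g) f₁ ⊠ f₂` on both sides, `⊠ f₂`-cancellation).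
* §4 **`parabolic_toRep_conj_scaleTransportSection`** — THE PARABOLIC NORMALISATION TRANSPORTS: if `s^𝔻` satisfies
  `(ω(m′ s^𝔻(p′) m′⁻¹) Φ)(0) = c(p′) Φ(0)` for every `m′` moving `ℓ_Δ` onto `ℓ_Y` and every `p′ ∈ P_Δ`, then the transported
  section satisfies the same clause in the `(T₀, δ/a)`-model with the scalar `c ∘ scaleInl` (take `m′` with `scaleTransportElt m′ = m`:
  `e′_a` preserves `ℓ_Δ` and `ℓ_Y`, conjugation commutes with the transport, `toRep_conj_scaleTransportSection`).
* §5 the line model of `LocalLineModelTransport` IS the scale model at `T′ = gram e₁ T_V (a)`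
  (`localLineInl_eq_scaleInl`, `lineTransportSection_eq_scaleTransportSection`).

References: [MoeglinVignerasWaldspurger1987] Chap. 2 II.1 (A)–(B), II.1 Rem. (6); [Weil1964] n° 34; [GelbartRogawski1991]
§3.1 Prop. 3.1.1 p. 455; [Kudla1994] §3, Thm. 3.1; [HarrisKudlaSweet1996] §1 (1.9)–(1.16); [Liu2021] App. D §D.1.
-/

set_option autoImplicit false

noncomputable section

open scoped Matrix Kronecker
open NumberField IsDedekindDomain
open Literature.RepresentationTheory.HeisenbergGroup
open Literature.NumberTheory.Automorphic Literature.NumberTheory.Automorphic.UnitaryGroup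
open Literature.NumberTheory.Automorphic.Liu2021.Def411WeilCarriers (TW JW JW_eq isSymm_TW)

/-! ## §1 Generic `S̃p_ψ`: elements are determined by projection and operator -/

namespace Literature.RepresentationTheory.HeisenbergGroup

section Ext

variable {R : Type*} [CommRing R] [Invertible (2 : R)] {V : Type*} [AddCommGroup V] [Module R V]
  {B : V →ₗ[R] V →ₗ[R] R} {k : Type*} [Field k] {S : Type*} [AddCommGroup S] [Module k S]
  {ρ : Representation k (Heisenberg B) S}

/-- an element `(g, M)` of MVW's group of pairs is determined by `g = π(g, M)` and the operator `M = ω(g, M)`.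
[cite: MoeglinVignerasWaldspurger1987, Chap. 2 II.1 (B)] -/
theorem MpPsi.ext_of_proj_of_toRep {x y : MpPsi ρ} (h₁ : MpPsi.proj ρ x = MpPsi.proj ρ y)
    (h₂ : ∀ f, MpPsi.toRep ρ x f = MpPsi.toRep ρ y f) : x = y :=
  Subtype.ext (Prod.ext h₁ (LinearEquiv.ext fun f => by simpa only [MpPsi.toRep_apply] using h₂ f))

end Ext

end Literature.RepresentationTheory.HeisenbergGroup

namespace Literature.NumberTheory.GelbartRogawski1991.UnitaryDualPair.LocalSplitting

variable (F E : Type) [Field F] [NumberField F] [Field E] [NumberField E] [Algebra F E]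
  [Algebra.IsQuadraticExtension F E] (c : E ≃ₐ[F] E) (N : ℕ)
  {δ : E} (hcδ : c δ = -δ) (hδ : δ ≠ 0) {d : F} (hd : δ * δ = algebraMap F E d)
  (T T' : Matrix (Fin N) (Fin N) F) (hT : T.IsSymm) (hT' : T'.IsSymm) (a : Fˣ) (hTT' : T' = (a : F) • T)
  {J J' : Matrix (Fin N) (Fin N) E} (hJ : J = T.map (algebraMap F E)) (hJ' : J' = T'.map (algebraMap F E))
  (v : HeightOneSpectrum (𝓞 F))

/-! ### Every element of the `T`-model is a transported element -/

section EltInv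

omit [Algebra.IsQuadraticExtension F E] in
/-- `(e′_a⁻¹ g e′_a, M) ∈ S̃p_ψ(β_{T′})` for `(g, M) ∈ S̃p_ψ(β_T)` (same operator). [cite: MoeglinVignerasWaldspurger1987, Chap. 2 II.1 (A)] -/
theorem symplecticConj_symm_mem_MpPsi (m : LocalMp F N T v) :
    (((symplecticConj (lineScale (unitAt F a v)) (polar_localPairing_lineScale_of_eq_smul F N T T' a hTT' v)).symm m.1.1, m.1.2) :
        LocalSp F N T' v × (SchwartzBruhat (Fin N → v.adicCompletion F) ≃ₗ[ℂ] SchwartzBruhat (Fin N → v.adicCompletion F))) ∈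
      MpPsi (localSchrodinger F N T' v) := by
  rw [mem_MpPsi]
  refine (implements_iff_implements_symplecticConj_lineScale_of_eq_smul F N T T' a hTT' v _ m.1.2).1 ?_
  rw [MulEquiv.apply_symm_apply]
  exact (mem_MpPsi _ _).1 m.2

omit [Algebra.IsQuadraticExtension F E] in
/-- the transport of `(e′_a⁻¹ π(m) e′_a, M)` is `m`. [cite: MoeglinVignerasWaldspurger1987, Chap. 2 II.1 (B)] -/
theorem scaleTransportElt_mk_symm (m : LocalMp F N T v) :
    scaleTransportElt F N T T' a hTT' v ⟨_, symplecticConj_symm_mem_MpPsi F N T T' a hTT' v m⟩ = m := by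
  refine MpPsi.ext_of_proj_of_toRep ?_ fun f => ?_
  · rw [proj_scaleTransportElt, MpPsi.proj_apply, MpPsi.proj_apply]
    exact (symplecticConj (lineScale (unitAt F a v)) (polar_localPairing_lineScale_of_eq_smul F N T T' a hTT' v)).apply_symm_apply _
  · rw [toRep_scaleTransportElt, MpPsi.toRep_apply, MpPsi.toRep_apply]

omit [Algebra.IsQuadraticExtension F E] in
/-- the projection of `(e′_a⁻¹ π(m) e′_a, M)`, as a linear map, is `e′_a⁻¹ ∘ π(m) ∘ e′_a`. [cite: MoeglinVignerasWaldspurger1987, Chap. 2 II.1 (B)] -/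
theorem toLin_proj_mk_symm (m : LocalMp F N T v) :
    toLin F v (MpPsi.proj _ (⟨_, symplecticConj_symm_mem_MpPsi F N T T' a hTT' v m⟩ : LocalMp F N T' v)) =
      (((lineScale (unitAt F a v) : ((Fin N → v.adicCompletion F) × (Fin N → v.adicCompletion F)) ≃ₗ[v.adicCompletion F]
            ((Fin N → v.adicCompletion F) × (Fin N → v.adicCompletion F))).symm :
          ((Fin N → v.adicCompletion F) × (Fin N → v.adicCompletion F)) →ₗ[v.adicCompletion F]
            ((Fin N → v.adicCompletion F) × (Fin N → v.adicCompletion F))) ∘ₗ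
        (toLin F v (MpPsi.proj _ m) ∘ₗ
          ((lineScale (unitAt F a v) : ((Fin N → v.adicCompletion F) × (Fin N → v.adicCompletion F)) ≃ₗ[v.adicCompletion F]
              ((Fin N → v.adicCompletion F) × (Fin N → v.adicCompletion F))) :
            ((Fin N → v.adicCompletion F) × (Fin N → v.adicCompletion F)) →ₗ[v.adicCompletion F]
              ((Fin N → v.adicCompletion F) × (Fin N → v.adicCompletion F))))) := by
  refine LinearMap.ext fun w => ?_
  rw [MpPsi.proj_apply]
  change ((symplecticConj (lineScale (unitAt F a v)) (polar_localPairing_lineScale_of_eq_smul F N T T' a hTT' v)).symm m.1.1 :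
      ((Fin N → v.adicCompletion F) × (Fin N → v.adicCompletion F)) ≃ₗ[v.adicCompletion F]
        ((Fin N → v.adicCompletion F) × (Fin N → v.adicCompletion F))) w =
    (lineScale (unitAt F a v)).symm ((MpPsi.proj _ m : ((Fin N → v.adicCompletion F) × (Fin N → v.adicCompletion F)) ≃ₗ[v.adicCompletion F]
        ((Fin N → v.adicCompletion F) × (Fin N → v.adicCompletion F))) (lineScale (unitAt F a v) w))
  rw [symplecticConj_symm_apply, MpPsi.proj_apply]

omit [Algebra.IsQuadraticExtension F E] in
/-- **every `m = (π(m), M) ∈ S̃p_ψ(β_T)` is the transport of an `m′ ∈ S̃p_ψ(β_{T′})`** (same operator), whose projection, as a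
linear map, is `e′_a⁻¹ ∘ π(m) ∘ e′_a`. [cite: MoeglinVignerasWaldspurger1987, Chap. 2 II.1 (A)–(B)] -/
theorem exists_scaleTransportElt_eq (m : LocalMp F N T v) :
    ∃ m' : LocalMp F N T' v, scaleTransportElt F N T T' a hTT' v m' = m ∧
      toLin F v (MpPsi.proj _ m') =
        (((lineScale (unitAt F a v) : ((Fin N → v.adicCompletion F) × (Fin N → v.adicCompletion F)) ≃ₗ[v.adicCompletion F]
              ((Fin N → v.adicCompletion F) × (Fin N → v.adicCompletion F))).symm :
            ((Fin N → v.adicCompletion F) × (Fin N → v.adicCompletion F)) →ₗ[v.adicCompletion F]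
              ((Fin N → v.adicCompletion F) × (Fin N → v.adicCompletion F))) ∘ₗ
          (toLin F v (MpPsi.proj _ m) ∘ₗ
            ((lineScale (unitAt F a v) : ((Fin N → v.adicCompletion F) × (Fin N → v.adicCompletion F)) ≃ₗ[v.adicCompletion F]
                ((Fin N → v.adicCompletion F) × (Fin N → v.adicCompletion F))) :
              ((Fin N → v.adicCompletion F) × (Fin N → v.adicCompletion F)) →ₗ[v.adicCompletion F]
                ((Fin N → v.adicCompletion F) × (Fin N → v.adicCompletion F))))) :=
  ⟨_, scaleTransportElt_mk_symm F N T T' a hTT' v m, toLin_proj_mk_symm F N T T' a hTT' v m⟩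

end EltInv

/-! ## §2 `e′_a` preserves `ℓ_Δ` and `ℓ_Y`; the Siegel parabolic and `det_Δ` do not see the retyping -/

section Lagrangians

variable {F}

/-- **`e′_t ℓ_Δ = ℓ_Δ`** (`e′_t (x, y) = (x, t•y)` acts index-wise, so equal halves stay equal).
[cite: HarrisKudlaSweet1996, §1 (1.11)] -/
theorem map_lineScale_deltaLagrangian {n : ℕ} (t : (v.adicCompletion F)ˣ) :
    (deltaLagrangian F v n).map
        ((lineScale t : ((Fin (n + n) → v.adicCompletion F) × (Fin (n + n) → v.adicCompletion F)) ≃ₗ[v.adicCompletion F]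
            ((Fin (n + n) → v.adicCompletion F) × (Fin (n + n) → v.adicCompletion F))) :
          ((Fin (n + n) → v.adicCompletion F) × (Fin (n + n) → v.adicCompletion F)) →ₗ[v.adicCompletion F]
            ((Fin (n + n) → v.adicCompletion F) × (Fin (n + n) → v.adicCompletion F))) =
      deltaLagrangian F v n := by
  have key : ∀ (s : (v.adicCompletion F)ˣ) (p : (Fin (n + n) → v.adicCompletion F) × (Fin (n + n) → v.adicCompletion F)),
      p ∈ deltaLagrangian F v n → lineScale s p ∈ deltaLagrangian F v n := by
    intro s p hp i
    refine ⟨(hp i).1, ?_⟩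
    rw [lineScale_apply]
    simp only [Pi.smul_apply, (hp i).2]
  refine le_antisymm ?_ ?_
  · rintro _ ⟨p, hp, rfl⟩
    exact key t p hp
  · intro p hp
    refine ⟨(lineScale t).symm p, ?_, LinearEquiv.apply_symm_apply _ _⟩
    have h := key t⁻¹ p hp
    have hsymm : (lineScale t).symm p = lineScale t⁻¹ p := by
      rw [lineScale_symm_apply, lineScale_apply]
    rw [SetLike.mem_coe, hsymm]
    exact h

/-- **`e′_t⁻¹ ℓ_Y = ℓ_Y`** (`ℓ_Y = 0 × F_vᴺ`, the Lagrangian of the Schrödinger model's Siegel parabolic). [cite: MoeglinVignerasWaldspurger1987, Chap. 2 II.1] -/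
theorem map_lineScale_symm_lagrangianY (t : (v.adicCompletion F)ˣ) :
    (lagrangianY F N v).map
        (((lineScale t).symm : ((Fin N → v.adicCompletion F) × (Fin N → v.adicCompletion F)) ≃ₗ[v.adicCompletion F]
            ((Fin N → v.adicCompletion F) × (Fin N → v.adicCompletion F))) :
          ((Fin N → v.adicCompletion F) × (Fin N → v.adicCompletion F)) →ₗ[v.adicCompletion F]
            ((Fin N → v.adicCompletion F) × (Fin N → v.adicCompletion F))) =
      lagrangianY F N v := by
  have key : ∀ (s : (v.adicCompletion F)ˣ) (p : (Fin N → v.adicCompletion F) × (Fin N → v.adicCompletion F)),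
      p ∈ lagrangianY F N v → lineScale s p ∈ lagrangianY F N v := by
    intro s p hp
    rw [lagrangianY, Submodule.mem_prod] at hp ⊢
    exact ⟨by rw [lineScale_apply]; exact hp.1, Submodule.mem_top⟩
  refine le_antisymm ?_ ?_
  · rintro _ ⟨p, hp, rfl⟩
    have hsymm : (lineScale t).symm p = lineScale t⁻¹ p := by rw [lineScale_symm_apply, lineScale_apply]
    change (lineScale t).symm p ∈ lagrangianY F N v
    rw [hsymm]
    exact key t⁻¹ p hp
  · intro p hp
    exact ⟨lineScale t p, key t p hp, LinearEquiv.symm_apply_apply _ _⟩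

variable (F)
variable {n : ℕ} {T₀ T₀' : Matrix (Fin n) (Fin n) F} {J₀ J₀' : Matrix (Fin n) (Fin n) E} {JD JD' : Matrix (Fin (n + n)) (Fin (n + n)) E}
/- (every hypothesis explicit per declaration — no section `variable` carrying a Prop, per the gate's D-0026 readout) -/

omit [NumberField F] in
/-- `gramD n T₀′ = a • gramD n T₀` for `T₀′ = a • T₀`. [cite: HarrisKudlaSweet1996, §1 (1.9)] -/
theorem gramD_of_eq_smul (hTT₀ : T₀' = (a : F) • T₀) : gramD F n T₀' = (a : F) • gramD F n T₀ := by
  rw [hTT₀, gramD_smul]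

/-- **the Siegel parabolic does not see the retyping**: `scaleInl p ∈ P_Δ(H′) ↔ p ∈ P_Δ(H)` (block condition on the same
family of matrices; any trace-zero elements on the two sides). [cite: Kudla1994, §3] [cite: HarrisKudlaSweet1996, §1 (1.11)] -/
theorem isSiegelDelta_scaleInl_iff (hT₀ : T₀.IsSymm) (hT₀' : T₀'.IsSymm) (hDD : gramD F n T₀' = (a : F) • gramD F n T₀)
    (hJD : JD = (gramD F n T₀).map (algebraMap F E)) (hJD' : JD' = (gramD F n T₀').map (algebraMap F E))
    {δ₁ : E} (hcδ₁ : c δ₁ = -δ₁) (hδ₁ : δ₁ ≠ 0) {d₁ : F} (hd₁ : δ₁ * δ₁ = algebraMap F E d₁)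
    {δ₂ : E} (hcδ₂ : c δ₂ = -δ₂) (hδ₂ : δ₂ ≠ 0) {d₂ : F} (hd₂ : δ₂ * δ₂ = algebraMap F E d₂)
    (p : localPi E c (n + n) JD v) :
    IsSiegelDelta F E c hcδ₁ hδ₁ hd₁ v n hT₀' hJD'
        (scaleInl F E c (n + n) (gramD F n T₀) (gramD F n T₀') a hDD hJD hJD' v p) ↔
      IsSiegelDelta F E c hcδ₂ hδ₂ hd₂ v n hT₀ hJD p := by
  rw [isSiegelDelta_iff_blocks, isSiegelDelta_iff_blocks, coe_scaleInl]

omit [Algebra.IsQuadraticExtension F E] in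
/-- `det_Δ (scaleInl p) = det_Δ p`. [cite: Kudla1994, §3] -/
theorem detDelta_scaleInl (hDD : gramD F n T₀' = (a : F) • gramD F n T₀) (hJD : JD = (gramD F n T₀).map (algebraMap F E))
    (hJD' : JD' = (gramD F n T₀').map (algebraMap F E)) (w : PlacesOver E v) (p : localPi E c (n + n) JD v) :
    detDelta F E c v n w (scaleInl F E c (n + n) (gramD F n T₀) (gramD F n T₀') a hDD hJD hJD' v p) = detDelta F E c v n w p := by
  unfold detDelta deltaBlock
  rw [coe_scaleInl]

omit [Algebra.IsQuadraticExtension F E] in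
/-- `χ_v(det_Δ (scaleInl p)) = χ_v(det_Δ p)`. [cite: HarrisKudlaSweet1996, §1 (1.15)] -/
theorem chiDet_scaleInl (hDD : gramD F n T₀' = (a : F) • gramD F n T₀) (hJD : JD = (gramD F n T₀).map (algebraMap F E))
    (hJD' : JD' = (gramD F n T₀').map (algebraMap F E)) (χv : ∀ w : PlacesOver E v, (w.1.adicCompletion E)ˣ →* ℂˣ)
    (p : localPi E c (n + n) JD v) :
    chiDet F E c v n χv (scaleInl F E c (n + n) (gramD F n T₀) (gramD F n T₀') a hDD hJD hJD' v p) = chiDet F E c v n χv p := by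
  classical
  unfold chiDet
  refine Finset.prod_congr rfl fun w _ => ?_
  have e := detDelta_scaleInl F E c a v hDD hJD hJD' w p
  by_cases hu : IsUnit (detDelta F E c v n w p)
  · have hu' : IsUnit (detDelta F E c v n w (scaleInl F E c (n + n) (gramD F n T₀) (gramD F n T₀') a hDD hJD hJD' v p)) := by
      rw [e]; exact hu
    have hunit : hu'.unit = hu.unit := Units.ext (by rw [IsUnit.unit_spec, IsUnit.unit_spec, e])
    rw [dif_pos hu', dif_pos hu, hunit]
  · have hu' : ¬ IsUnit (detDelta F E c v n w (scaleInl F E c (n + n) (gramD F n T₀) (gramD F n T₀') a hDD hJD hJD' v p)) := by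
      rw [e]; exact hu
    rw [dif_neg hu', dif_neg hu]

omit [Algebra.IsQuadraticExtension F E] in
/-- **`g ⊕ 1` commutes with the retyping**: `inlLoc (scaleInl g) = scaleInl (inlLoc g)` in `U(a•(J ⊕ −J))(F_v)` (both have
components `reindex e₂ (g_w ⊕ 1)`). [cite: GelbartRogawski1991, §3.1 Prop. 3.1.1 p. 455 L1–3] -/
theorem inlLoc_scaleInl (hTT₀ : T₀' = (a : F) • T₀) (hDD : gramD F n T₀' = (a : F) • gramD F n T₀)
    (hJ₀ : J₀ = T₀.map (algebraMap F E)) (hJ₀' : J₀' = T₀'.map (algebraMap F E))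
    (hJD : JD = (gramD F n T₀).map (algebraMap F E)) (hJD' : JD' = (gramD F n T₀').map (algebraMap F E))
    (g : localPi E c n J₀ v) :
    inlLoc F E c v n hJ₀' hJD' (scaleInl F E c n T₀ T₀' a hTT₀ hJ₀ hJ₀' v g) =
      scaleInl F E c (n + n) (gramD F n T₀) (gramD F n T₀') a hDD hJD hJD' v (inlLoc F E c v n hJ₀ hJD g) := by
  refine Subtype.ext (funext fun w => ?_)
  rw [inlLoc_apply, coe_scaleInl, coe_scaleInl, inlLoc_apply]

end Lagrangians

/-! ## §3 Undoubling commutes with the scale transport -/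

section Undoubling

variable {n : ℕ} {T₀ T₀' : Matrix (Fin n) (Fin n) F} {J₀ J₀' : Matrix (Fin n) (Fin n) E} {JD JD' : Matrix (Fin (n + n)) (Fin (n + n)) E}

/-- **UNDOUBLING COMMUTES WITH THE SCALE TRANSPORT.**  For a section `s^𝔻` of `H′ = U(a•(J ⊕ −J))(F_v)` over `ι^𝔻_δ`:
transporting the undoubled section `undoubleLoc s^𝔻 : U(a•J)(F_v) →* S̃p(β_{a•T₀})` to the `(T₀, δ/a)`-model (`scaleTransportSection`
at rank `n`) gives the undoubling of the transported doubled section (`scaleTransportSection` at rank `n + n`): both are over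
`ι^{T₀}_{δ/a}` and `ω(s^𝔻((scaleInl g) ⊕ 1)) = ω(s^𝔻(scaleInl (g ⊕ 1)))` strips to the same operator.
[cite: GelbartRogawski1991, §3.1 Prop. 3.1.1 p. 455 L1–3] [cite: MoeglinVignerasWaldspurger1987, Chap. 2 II.1 Rem. (6)] -/
theorem scaleTransportSection_undoubleLoc (hT₀ : T₀.IsSymm) (hT₀' : T₀'.IsSymm) (hT₀d : IsUnit T₀.det)
    (hT₀'d : IsUnit T₀'.det) (hTT₀ : T₀' = (a : F) • T₀) (hDD : gramD F n T₀' = (a : F) • gramD F n T₀)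
    (hJ₀ : J₀ = T₀.map (algebraMap F E)) (hJ₀' : J₀' = T₀'.map (algebraMap F E))
    (hJD : JD = (gramD F n T₀).map (algebraMap F E)) (hJD' : JD' = (gramD F n T₀').map (algebraMap F E))
    (sD' : localPi E c (n + n) JD' v →* LocalMp F (n + n) (gramD F n T₀') v)
    (hsD' : ∀ h, MpPsi.proj _ (sD' h) = iota F E c (n + n) hcδ hδ hd (gramD F n T₀') (gramD_isSymm F n hT₀') hJD' v h) :
    scaleTransportSection F E c n hcδ hδ hd T₀ T₀' hT₀ hT₀' a hTT₀ hJ₀ hJ₀' v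
        (undoubleLoc F E c v n hJ₀' hJD' hcδ hδ hd hT₀' hT₀'d sD' hsD')
        (proj_undoubleLoc F E c v n hJ₀' hJD' hcδ hδ hd hT₀' hT₀'d sD' hsD') =
      undoubleLoc F E c v n hJ₀ hJD (conj_lineDelta hcδ a) (lineDelta_ne_zero hδ a) (lineDelta_mul_self hd a) hT₀ hT₀d
        (scaleTransportSection F E c (n + n) hcδ hδ hd (gramD F n T₀) (gramD F n T₀') (gramD_isSymm F n hT₀)
          (gramD_isSymm F n hT₀') a hDD hJD hJD' v sD' hsD')
        (proj_scaleTransportSection F E c (n + n) hcδ hδ hd (gramD F n T₀) (gramD F n T₀') (gramD_isSymm F n hT₀)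
          (gramD_isSymm F n hT₀') a hDD hJD hJD' v sD' hsD') := by
  refine MonoidHom.ext fun g => MpPsi.ext_of_proj_of_toRep ?_ fun f₁ => ?_
  · rw [proj_scaleTransportSection, proj_undoubleLoc]
  · obtain ⟨f₂, hf₂⟩ := exists_schwartzBruhat_pi_ne_zero (v.adicCompletion F) (Fin n)
    refine boxSB_left_cancel (v.adicCompletion F) (e₂ n) hf₂ ?_
    -- left: the undoubled-then-transported section has the operators of `undoubleLoc s^𝔻` at `scaleInl g`
    have A := LinearMap.congr_fun (toRep_scaleTransportSection F E c n hcδ hδ hd T₀ T₀' hT₀ hT₀' a hTT₀ hJ₀ hJ₀' v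
      (undoubleLoc F E c v n hJ₀' hJD' hcδ hδ hd hT₀' hT₀'d sD' hsD')
      (proj_undoubleLoc F E c v n hJ₀' hJD' hcδ hδ hd hT₀' hT₀'d sD' hsD') g) f₁
    have B := toRep_undoubleLoc_boxSB F E c v n hJ₀' hJD' hcδ hδ hd hT₀' hT₀'d sD' hsD'
      (scaleInl F E c n T₀ T₀' a hTT₀ hJ₀ hJ₀' v g) f₁ f₂
    -- right: the transported-then-undoubled section
    have C := toRep_undoubleLoc_boxSB F E c v n hJ₀ hJD (conj_lineDelta hcδ a) (lineDelta_ne_zero hδ a)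
      (lineDelta_mul_self hd a) hT₀ hT₀d
      (scaleTransportSection F E c (n + n) hcδ hδ hd (gramD F n T₀) (gramD F n T₀') (gramD_isSymm F n hT₀)
        (gramD_isSymm F n hT₀') a hDD hJD hJD' v sD' hsD')
      (proj_scaleTransportSection F E c (n + n) hcδ hδ hd (gramD F n T₀) (gramD F n T₀') (gramD_isSymm F n hT₀)
        (gramD_isSymm F n hT₀') a hDD hJD hJD' v sD' hsD') g f₁ f₂
    have D := LinearMap.congr_fun (toRep_scaleTransportSection F E c (n + n) hcδ hδ hd (gramD F n T₀) (gramD F n T₀')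
      (gramD_isSymm F n hT₀) (gramD_isSymm F n hT₀') a hDD hJD hJD' v sD' hsD' (inlLoc F E c v n hJ₀ hJD g))
      (boxSB (v.adicCompletion F) (e₂ n) f₁ f₂)
    have K := inlLoc_scaleInl F E c a v hTT₀ hDD hJ₀ hJ₀' hJD hJD' g
    -- (hygiene: an explicit chain of equalities, no pattern search across the two models)
    exact (congrArg (fun φ => boxSB (v.adicCompletion F) (e₂ n) φ f₂) A).trans
      (B.symm.trans ((congrArg (fun h => MpPsi.toRep (localSchrodinger F (n + n) (gramD F n T₀') v) (sD' h)
        (boxSB (v.adicCompletion F) (e₂ n) f₁ f₂)) K).trans (D.symm.trans C)))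

end Undoubling

/-! ## §4 The parabolic normalisation transports -/

section Parabolic

variable {n : ℕ} {T₀ T₀' : Matrix (Fin n) (Fin n) F} {JD JD' : Matrix (Fin (n + n)) (Fin (n + n)) E}

/-- **THE PARABOLIC NORMALISATION TRANSPORTS.**  If the doubled section `s^𝔻` of `H′` satisfies
`(ω(m′ s^𝔻(p′) m′⁻¹) Φ)(0) = c(p′) Φ(0)` for every `m′ ∈ S̃p(β_{a•T^𝔻})` whose projection carries `ℓ_Δ` onto `ℓ_Y` and every
`p′ ∈ P_Δ(H′)`, then its scale transport `Σ` satisfies, for every `m ∈ S̃p(β_{T^𝔻})` whose projection carries `ℓ_Δ` onto `ℓ_Y`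
and every `p ∈ P_Δ(H)` (for the trace-zero element `δ/a`), `(ω(m Σ(p) m⁻¹) Φ)(0) = c(scaleInl p) Φ(0)` — with
`m′` any element transporting to `m` (`exists_scaleTransportElt_eq`; `e′_a` preserves `ℓ_Δ` and `ℓ_Y`). [cite: Kudla1994, Thm 3.1] [cite: HarrisKudlaSweet1996, §1 (1.16)] -/
theorem parabolic_toRep_conj_scaleTransportSection (hT₀ : T₀.IsSymm) (hT₀' : T₀'.IsSymm)
    (hDD : gramD F n T₀' = (a : F) • gramD F n T₀)
    (hJD : JD = (gramD F n T₀).map (algebraMap F E)) (hJD' : JD' = (gramD F n T₀').map (algebraMap F E))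
    (sD' : localPi E c (n + n) JD' v →* LocalMp F (n + n) (gramD F n T₀') v)
    (hsD' : ∀ h, MpPsi.proj _ (sD' h) = iota F E c (n + n) hcδ hδ hd (gramD F n T₀') (gramD_isSymm F n hT₀') hJD' v h)
    (cΔ : localPi E c (n + n) JD' v → ℂ)
    (hΔ : ∀ m' : LocalMp F (n + n) (gramD F n T₀') v,
      (deltaLagrangian F v n).map (toLin F v (MpPsi.proj _ m')) = lagrangianY F (n + n) v →
      ∀ p', IsSiegelDelta F E c hcδ hδ hd v n hT₀' hJD' p' →
      ∀ Φ : SchwartzBruhat (Fin (n + n) → v.adicCompletion F),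
        ((MpPsi.toRep _ (m' * sD' p' * m'⁻¹) Φ : SchwartzBruhat (Fin (n + n) → v.adicCompletion F)) :
          (Fin (n + n) → v.adicCompletion F) → ℂ) 0 = cΔ p' * (Φ : (Fin (n + n) → v.adicCompletion F) → ℂ) 0)
    (m : LocalMp F (n + n) (gramD F n T₀) v)
    (hm : (deltaLagrangian F v n).map (toLin F v (MpPsi.proj _ m)) = lagrangianY F (n + n) v)
    (p : localPi E c (n + n) JD v)
    (hp : IsSiegelDelta F E c (conj_lineDelta hcδ a) (lineDelta_ne_zero hδ a) (lineDelta_mul_self hd a) v n hT₀ hJD p)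
    (Φ : SchwartzBruhat (Fin (n + n) → v.adicCompletion F)) :
    ((MpPsi.toRep _ (m * scaleTransportSection F E c (n + n) hcδ hδ hd (gramD F n T₀) (gramD F n T₀') (gramD_isSymm F n hT₀)
          (gramD_isSymm F n hT₀') a hDD hJD hJD' v sD' hsD' p * m⁻¹) Φ :
        SchwartzBruhat (Fin (n + n) → v.adicCompletion F)) : (Fin (n + n) → v.adicCompletion F) → ℂ) 0 =
      cΔ (scaleInl F E c (n + n) (gramD F n T₀) (gramD F n T₀') a hDD hJD hJD' v p) *
        (Φ : (Fin (n + n) → v.adicCompletion F) → ℂ) 0 := by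
  -- a `T₀′`-model element `m′` transporting to `m`; the mover condition transports: `e′⁻¹ π(m) e′` carries `ℓ_Δ` onto `ℓ_Y`
  obtain ⟨m', hmm', h1⟩ := exists_scaleTransportElt_eq F (n + n) (gramD F n T₀) (gramD F n T₀') a hDD v m
  have hmover : (deltaLagrangian F v n).map (toLin F v (MpPsi.proj _ m')) = lagrangianY F (n + n) v := by
    have h2 := map_lineScale_deltaLagrangian (F := F) v (n := n) (unitAt F a v)
    have h3 := map_lineScale_symm_lagrangianY (F := F) (n + n) v (unitAt F a v)
    rw [h1, Submodule.map_comp, Submodule.map_comp, h2, hm, h3]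
  have hp' : IsSiegelDelta F E c hcδ hδ hd v n hT₀' hJD'
      (scaleInl F E c (n + n) (gramD F n T₀) (gramD F n T₀') a hDD hJD hJD' v p) :=
    (isSiegelDelta_scaleInl_iff F E c a v hT₀ hT₀' hDD hJD hJD' hcδ hδ hd (conj_lineDelta hcδ a) (lineDelta_ne_zero hδ a)
      (lineDelta_mul_self hd a) p).2 hp
  have key := hΔ _ hmover _ hp' Φ
  have hconj := LinearMap.congr_fun (toRep_conj_scaleTransportSection F E c (n + n) hcδ hδ hd (gramD F n T₀) (gramD F n T₀')
    (gramD_isSymm F n hT₀) (gramD_isSymm F n hT₀') a hDD hJD hJD' v sD' hsD' m' p) Φ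
  rw [hmm'] at hconj
  rw [hconj]
  exact key

end Parabolic

/-! ## §5 The line model of `LocalLineModelTransport` is the scale model at `T′ = gram e₁ T_V (a)` -/

section LineModel

variable (TV : Matrix (Fin N) (Fin N) F) (JV : Matrix (Fin N) (Fin N) E)

omit [Algebra.IsQuadraticExtension F E] in
/-- `k ⊗ 1 = scaleInl k` at `e₁ = Equiv.prodUnique`: the two retypings of `U(J_V)(F_v)` into `U(J_V ⊗ (a))(F_v)` coincide.
[cite: MoeglinVignerasWaldspurger1987, Chap. 1 I.17] -/
theorem localLineInl_eq_scaleInl (hJV : JV = TV.map (algebraMap F E)) (k : localPi E c N JV v) :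
    localLineInl E c N (Equiv.prodUnique (Fin N) (Fin 1)) JV (JW F E a) v k =
      scaleInl F E c N TV (gram F (Equiv.prodUnique (Fin N) (Fin 1)) TV (TW F a)) a (gram_prodUnique_TW F N a TV) hJV
        (reindex_kronecker_eq_gram_map F E (Equiv.prodUnique (Fin N) (Fin 1)) hJV (JW_eq F E a)) v k := by
  refine Subtype.ext ?_
  rw [coe_scaleInl, coe_localLineInl]
  funext w
  refine Units.ext (Matrix.ext fun i j => ?_)
  rw [coe_localLineGL_apply, Matrix.reindex_apply, Matrix.submatrix_apply, Equiv.prodUnique_symm_apply,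
    Equiv.prodUnique_symm_apply, Matrix.kroneckerMap_apply, Matrix.one_apply_eq, mul_one]

/-- **the line-model transport IS the scale-model transport at `T′ = gram e₁ T_V (a)`** (same projections `ι^{T_V}_{δ/a}`, same
operators `M(s′(k ⊗ 1)) = M(s′(scaleInl k))`). [cite: MoeglinVignerasWaldspurger1987, Chap. 2 II.1] -/
theorem lineTransportSection_eq_scaleTransportSection (hV : TV.IsSymm) (hJV : JV = TV.map (algebraMap F E))
    (s' : localPi E c N (Matrix.reindex (Equiv.prodUnique (Fin N) (Fin 1)) (Equiv.prodUnique (Fin N) (Fin 1)) (JV ⊗ₖ JW F E a)) v →*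
      LocalMp F N (gram F (Equiv.prodUnique (Fin N) (Fin 1)) TV (TW F a)) v)
    (hs' : ∀ g, MpPsi.proj _ (s' g) = iota F E c N hcδ hδ hd (gram F (Equiv.prodUnique (Fin N) (Fin 1)) TV (TW F a))
      (isSymm_gram F (Equiv.prodUnique (Fin N) (Fin 1)) hV (isSymm_TW F a))
      (reindex_kronecker_eq_gram_map F E (Equiv.prodUnique (Fin N) (Fin 1)) hJV (JW_eq F E a)) v g) :
    lineTransportSection F E c N hcδ hδ hd TV hV JV hJV a v s' hs' =
      scaleTransportSection F E c N hcδ hδ hd TV (gram F (Equiv.prodUnique (Fin N) (Fin 1)) TV (TW F a)) hV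
        (isSymm_gram F (Equiv.prodUnique (Fin N) (Fin 1)) hV (isSymm_TW F a)) a (gram_prodUnique_TW F N a TV) hJV
        (reindex_kronecker_eq_gram_map F E (Equiv.prodUnique (Fin N) (Fin 1)) hJV (JW_eq F E a)) v s' hs' := by
  refine MonoidHom.ext fun g => MpPsi.ext_of_proj_of_toRep ?_ fun f => ?_
  · rw [proj_lineTransportSection, proj_scaleTransportSection]
  · rw [toRep_lineTransportSection, toRep_scaleTransportSection, localLineInl_eq_scaleInl F E c N a v TV JV hJV]

end LineModel

/-! ### Build-lane note (ops-buildfix G11b-3 recipe, LEDGER B13-1, 2026-08-21)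
As in the `LocalDoubledUnitary*` / `LocalKudlaSplitting*` siblings: the public theorems with very large dependent binder
telescopes are tagged `[implicit_reducible]` ONLY to keep them out of `lean -o`'s library-suggestion index (inert for the
kernel; no statement or proof is changed). -/
set_option allowUnsafeReducibility true in
attribute [implicit_reducible]
  scaleTransportSection_undoubleLoc parabolic_toRep_conj_scaleTransportSection lineTransportSection_eq_scaleTransportSection
  isSiegelDelta_scaleInl_iff inlLoc_scaleInl

end Literature.NumberTheory.GelbartRogawski1991.UnitaryDualPair.LocalSplitting

end
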